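import Summits.BirchSwinnertonDyer.BirchSwinnertonDyer.Theses.UniversalToricDescent
import Summits.BirchSwinnertonDyer.BirchSwinnertonDyer.Theorems.EisensteinPrimesHidaLimitFittingBoundConverse
import HarnessLib

/-!
# NODE (D-0171) on crux stmt-BirchSwinnertonDyer-24207 `UniversalToricDescent.RationalSplitIMCInclusionAtThree`
# — line `eisenstein-orbit-amplification` (crux-ideate standing cover `cruxidea-stmt-BirchSwinnertonDyer-24207-1`, gen 14, 2026-08-31)

KIND: IMPLIED-BY (door), 0 sorry, no new axiom, no named fact consumed, `no_new_routes`.  Kernel theorems (checked):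
* `rationalSplitIMCInclusionAtThree_of_amplification :
    SquareCharGeneratorAtThree → SquareRootLFunctionAtThree → CommonFactorOnRigidRowsAtThree
      → RationalInclusionOffRigidRowsAtThree → crux`  (concludes the crux BY NAME);
* `eisensteinInclusion_of_amplification` — on rows where the ANALYTIC root `L₁` is irreducible the same three pieces give
  the RATIONAL EISENSTEIN INCLUSION `∃ k, 3^k·Ch·R₀⟦T⟧ ⊆ (L)` (= g0's P1 `EisensteinKatoSwap.EisensteinRationalInclusionAtThree`,
  restated verbatim below because crux workfiles are not importable), so that g0's checked λ-flip `P1 → P2 → crux` applies;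
* the two ring lemmas that carry the amplification: `dvd_of_irreducible_of_common_nonunit_factor`
  (IRREDUCIBLE `F`, a common non-unit factor of `F` and `G` ⟹ `F ∣ G`) and `mem_span_sq_of_dvd` / `span_sq_le_of_dvd`.

THE MOVE («Eisenstein-orbit amplification»).  Write `I := Ch_Λ(X_(∅,0))·R₀⟦T⟧`.  24207 asks `∃ k, 3^k·L ∈ I`, and the whole
lineage reads this prime-by-prime in the UFD `R₀⟦T⟧` («every distinguished irreducible `P ≠ 3` divides `L` to the power it
divides `Ch`», HANDOFF-utd-idea-g50 l.15): MULTIPLICITY-EXACT information at EVERY interior root, which is why annihilator /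
θ-element / rank-0 technology was discarded («annihilation gives lcm, not product», HANDOFF g6) and why only Euler-system-grade
supplies were ever considered.  Two rigidity facts remove the multiplicities:
(SQ) the algebraic divisor is a SQUARE, `I = (F₁²)` (piece `SquareCharGeneratorAtThree`; predicted by the BDP main conjecture
     since `L = 𝓛_𝔭(f)²`; in the ordinary case it follows from Howard's `X_tors ∼ M ⊕ M` and the rank-one Λ-adic class — at
     additive 3 the compact Selmer limit vanishes (universal norms are 0 at a deeply ramified additive prime), so it is a
     genuine pairing-theoretic target);
(AN) the analytic side is a square up to `3`-powers and a unit, `L = u·3^b·L₁²` (piece `SquareRootLFunctionAtThree`; true for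
     the BDP function by construction, BDP 2013 (5.1)–(5.2) / Castella–Hsieh 2018 Def. 3.7, and `IsBDPLFunction` pins `L`
     uniquely by Strassmann since its interpolation points accumulate in a closed disc of radius `< 1`);
and then IRREDUCIBILITY of one of the two square roots does the rest:
(RIGID-A) if `F₁` is irreducible in `R₀⟦T⟧` and `F₁, L₁` have ANY common non-unit factor, then `F₁ ∣ L₁`, hence `F₁² ∣ L₁²`,
     hence `L ∈ I` with `k = 0` — the KOLYVAGIN direction with NO degree comparison and NO class;
(RIGID-B) if `L₁` is irreducible and `F₁, L₁` have a common non-unit factor, then `L₁ ∣ F₁`, i.e. `3^b·I ⊆ (L)` — g0's P1 — and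
     g0's λ-dominance P2 finishes.
Irreducibility is CERTIFIED CHEAPLY: a power series whose constant coefficient is irreducible is irreducible
(`irreducible_of_irreducible_constantCoeff` below, any commutative ring); `R₀ = W(𝔽̄₃)` is a complete DVR with uniformiser 3
(Castella 2018 §3 — in the tree `unrIntegers 3` is a closed subring of `ℂ₃`, DVR-ness not yet typed), so a series whose
constant term has valuation exactly ONE (after stripping `μ`) is irreducible — the root-free Eisenstein criterion the tree
proved for `ℤ_p⟦T⟧` on crux 22298 (`Theorems.AlignedTransportAtTwo…EisensteinRigidity`,
`irreducible_of_norm_constantCoeff`; `…EisensteinRigidityPrime`, `prime_of_norm_constantCoeff`); more generally an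
Eisenstein–Dumas Newton polygon (one segment, coprime height/length) certifies it from finitely many coefficient valuations.
ALGEBRAIC certificate: `v_3(F₁²(0)) = 2`, i.e. `#Sel_(∅,0)(K, E[3^∞]) = 9` with no finite Λ-submodule (control at `T = 0` is
exact for (∅,0) on SC rows: `E(K_{∞,𝔭′})[3] = 0` as `ρ̄_{E,3}|G_{ℚ₃}` is irreducible); ANALYTIC certificate: `v(L(𝟙)) = 2` after `μ`,
i.e. `v_3` of the `p`-adic Waldspurger value `(log_𝔭 y_K)²·(unit)` (Euler factor `= 1` at additive 3).
A common non-unit factor of `F₁` and `L₁` in `R₀⟦T⟧` is exactly ONE COMMON ROOT in `ℂ₃` (one inertia orbit), with no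
multiplicity asked: piece `CommonFactorOnRigidRowsAtThree`.  That is the new SPEC for supply engines on rigid rows:
support/lcm/annihilation strength at a single orbit suffices (SUPPLY-GRID g59 §(c) partly answered: the MULTIPLICITY half of
«ord_x L ≥ ord_x F without classes» is forced by algebra; the SUPPORT half at one orbit remains).

PIECES AND TAGS (evidence in `Ideas/eisenstein-orbit-amplification.md`):
* `SquareCharGeneratorAtThree` (SQ) — **UNDECIDED · leaf IDEA-NEEDED/ATTACKABLE**: evenness of `Ch_Λ(X_(∅,0))` at additive 3;
  consequence of the two-sided BDP-IMC; ordinary-case mechanism (Howard M⊕M + Λ-adic class, Castella/BCK equivalence) is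
  unavailable because `lim_n Sel(K_n,T) = 0` here; candidate: generalised Cassels–Tate/Flach pairing for the pair
  (∅,0)/(0,∅) = τ(∅,0) through the 4-term Poitou–Tate sequence `0 → H¹_Iw → H¹_Iw(K_𝔭′) → X_(0,∅) → X_(0,0) → 0`.
* `SquareRootLFunctionAtThree` (AN) — **WEAKER (true for the BDP function) · leaf ATTACKABLE** after a definition request
  (typed square root `𝓛_𝔭(f)` with its toric-period interpolation; uniqueness under `IsBDPLFunction` by Strassmann).
* `CommonFactorOnRigidRowsAtThree` (ONE) — **UNDECIDED · leaf IDEA-NEEDED**: on rows where `F₁` or `L₁` is irreducible, `F₁` and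
  `L₁` are not coprime in `R₀⟦T⟧`.  Logically: on `F₁`-rigid rows ONE ⟺ the crux (given SQ, AN); on `L₁`-rigid rows ONE ⟺ g0-P1.
  Why easier: multiplicity-free and single-orbit, so lcm-, annihilator- and support-grade engines qualify (E1 Ribet-at-one-zero of
  `𝓛` in the U(2,1)/GU(2) Eisenstein family — classes of length ≥ 1 instead of ≥ ord = 2; E2 set-theoretic descent
  `Supp X₂ ∩ (ac line)` from the bounded `𝔭`-comb, where only supports, not multiplicities, must descend; E3 annihilation of
  `Sel_(∅,0)` by BDP theta elements).  Barrier placement: TraceZero / B1 / NoAdmissiblePrimes are untouched by (SQ),(AN) and by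
  the amplification (pure algebra); they bite the ENGINES for ONE exactly as before, but with a weaker output demanded.
* `RationalInclusionOffRigidRowsAtThree` — **RESIDUAL (= the crux restricted to rows where neither square root is
  certified irreducible) · BARRIER-tagged as the crux itself**; INSTRUMENTABLE: the Eisenstein census I-g14-1 decides its size.
* `EisensteinRationalInclusionAtThree` — g0's P1 VERBATIM (target of door B; not a new piece).
INSTRUMENT DATA: none run (kit 0).  Asks filed in the HANDOFF: I-g14-1 (census of `v_3(L(𝟙))`, `λ(𝓛)`, `#Sel_(∅,0)(K,E[3^∞])` on the
three smallest O6 rows and then the 2023-row table), I-g14-2 (Newton polygon of `𝓛` mod `3^4` on the D-g6-1 rows for Dumas).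
HONEST STATUS: nothing here proves BSD for any curve; ONE and SQ are research; the door is exact (no slack lost) on rigid rows.
-/

set_option autoImplicit false
set_option linter.dupNamespace false

noncomputable section

open scoped Classical

namespace Summit.BirchSwinnertonDyer.BirchSwinnertonDyer.Cruxes.RationalSplitIMCInclusionAtThree.EisensteinOrbitAmplification

/-! ## §A  The two ring lemmas (any commutative ring / monoid) -/

/-- **Amplification.** An IRREDUCIBLE element that shares a non-unit factor with `G` divides `G`
(one common root of an irreducible Weierstrass polynomial gives the whole orbit). -/
theorem dvd_of_irreducible_of_common_nonunit_factor {R : Type*} [CommMonoid R] {F G P : R}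
    (hF : Irreducible F) (hP : ¬ IsUnit P) (hPF : P ∣ F) (hPG : P ∣ G) : F ∣ G := by
  obtain ⟨Q, hQ⟩ := hPF
  rcases hF.isUnit_or_isUnit hQ with hPu | hQu
  · exact absurd hPu hP
  · obtain ⟨v, hv⟩ := hQu
    have hFP : F ∣ P := ⟨(↑v⁻¹ : R), by rw [hQ, ← hv, mul_assoc, Units.mul_inv, mul_one]⟩
    exact hFP.trans hPG

/-- **Door A algebra (Kolyvagin direction, no degree count).** `I = (F₁²)`, `L = u·c^b·L₁²`, `F₁ ∣ L₁` ⟹ `L ∈ I`. -/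
theorem mem_span_sq_of_dvd {R : Type*} [CommRing R] {I : Ideal R} {c L F₁ L₁ u : R} {b : ℕ}
    (hI : I = Ideal.span {F₁ ^ 2}) (hL : L = u * c ^ b * L₁ ^ 2) (hdvd : F₁ ∣ L₁) :
    ∃ k : ℕ, c ^ k * L ∈ I := by
  refine ⟨0, ?_⟩
  rw [pow_zero, one_mul, hI, Ideal.mem_span_singleton, hL]
  exact Dvd.dvd.mul_left (pow_dvd_pow_of_dvd hdvd 2) _

/-- **Door B algebra (Eisenstein direction).** `I = (F₁²)`, `L = u·c^b·L₁²` with `u` a unit, `L₁ ∣ F₁` ⟹ `c^b·I ⊆ (L)`. -/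
theorem span_sq_le_of_dvd {R : Type*} [CommRing R] {I : Ideal R} {c L F₁ L₁ u : R} {b : ℕ}
    (hI : I = Ideal.span {F₁ ^ 2}) (hu : IsUnit u) (hL : L = u * c ^ b * L₁ ^ 2) (hdvd : L₁ ∣ F₁) :
    ∃ k : ℕ, ∀ x ∈ I, c ^ k * x ∈ Ideal.span ({L} : Set R) := by
  refine ⟨b, fun x hx ↦ ?_⟩
  rw [hI, Ideal.mem_span_singleton] at hx
  rw [Ideal.mem_span_singleton, hL]
  have h1 : c ^ b * L₁ ^ 2 ∣ c ^ b * x :=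
    mul_dvd_mul_left _ ((pow_dvd_pow_of_dvd hdvd 2).trans hx)
  have h2 : u * c ^ b * L₁ ^ 2 ∣ u * (c ^ b * x) := by
    rw [mul_assoc]; exact mul_dvd_mul_left u h1
  exact (IsUnit.dvd_mul_left hu).mp h2

/-- **Field-level form of the amplification (for the record: roots instead of factors).** Over a field, an irreducible
monic `N` sharing a root with `M` in some extension divides `M`; with `deg M ≤ deg N` and `M` monic, `M = N`. -/
theorem eq_of_irreducible_of_common_root {F E : Type*} [Field F] [Field E] [Algebra F E]
    {N M : Polynomial F} (hN : Irreducible N) (hNm : N.Monic) (hMm : M.Monic) (β : E)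
    (hβN : Polynomial.aeval β N = 0) (hβM : Polynomial.aeval β M = 0)
    (hdeg : M.natDegree ≤ N.natDegree) : M = N := by
  have hmin : N = minpoly F β := minpoly.eq_of_irreducible_of_monic hN hβN hNm
  have hdvd : N ∣ M := by rw [hmin]; exact minpoly.dvd F β hβM
  exact Polynomial.eq_of_monic_of_dvd_of_natDegree_le hNm hMm hdvd hdeg

/-- **Root-free Eisenstein certificate.** A power series whose constant coefficient is irreducible is irreducible
(`H = A·B ⇒ H(0) = A(0)·B(0)`, and a power series is a unit iff its constant coefficient is).  Over the DVR `R₀` this reads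
`v(H(0)) = 1 ⟹ H` irreducible in `R₀⟦T⟧`: the certificate that makes a row RIGID. -/
theorem irreducible_of_irreducible_constantCoeff {R : Type*} [CommRing R] {H : PowerSeries R}
    (h : Irreducible (PowerSeries.constantCoeff H)) : Irreducible H := by
  refine ⟨fun hu ↦ h.not_isUnit (PowerSeries.isUnit_iff_constantCoeff.mp hu), ?_⟩
  intro a b hab
  have hc : PowerSeries.constantCoeff H = PowerSeries.constantCoeff a * PowerSeries.constantCoeff b := by
    rw [hab, map_mul]
  rcases h.isUnit_or_isUnit hc with ha | hb
  · exact Or.inl (PowerSeries.isUnit_iff_constantCoeff.mpr ha)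
  · exact Or.inr (PowerSeries.isUnit_iff_constantCoeff.mpr hb)

/-! ## §B  The pieces, under 24207's binders (verbatim prefix of the crux + `X` torsion, as in g0's P1/P2) -/

/-- **(SQ) [UNDECIDED · leaf IDEA-NEEDED/ATTACKABLE]** the extended characteristic ideal of `X_(∅,0)` is generated by a SQUARE:
`Ch_Λ(X_(∅,0))·R₀⟦T⟧ = (F₁²)`. -/
def SquareCharGeneratorAtThree : Prop :=
  ∀ (W : WeierstrassCurve ℚ) [W.IsElliptic] [W.IsGloballyMinimal] (N : ℕ) [NeZero N] (K : Type) [Field K] [NumberField K] (Dt : Literature.NumberTheory.EllipticCurves.ModularForms.ModularParametrizationData W N), Summit.BirchSwinnertonDyer.Rank1Residual.Additive.ClassO6 W 3 → W.HasSurjectiveModNGaloisRep 3 → W.analyticRank = 1 → W.conductorNorm ℤ = N → Literature.NumberTheory.EllipticCurves.IsImaginaryQuadratic K → Literature.NumberTheory.EllipticCurves.SatisfiesHeegnerHypothesis N K → ∀ (κ : Literature.NumberTheory.EllipticCurves.ZpExtension K 3), κ.IsAnticyclotomic → ∀ (γ : Field.absoluteGaloisGroup K) [Fact (κ.IsTopGenerator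 γ)] (𝔭 : IsDedekindDomain.HeightOneSpectrum (NumberField.RingOfIntegers K)), ((3 : ℕ) : NumberField.RingOfIntegers K) ∈ 𝔭.asIdeal → 𝔭.asIdeal.ramificationIdx (NumberField.RingOfIntegers ℚ) = 1 → 𝔭.asIdeal.inertiaDeg (NumberField.RingOfIntegers ℚ) = 1 → ∀ (𝔭' : IsDedekindDomain.HeightOneSpectrum (NumberField.RingOfIntegers K)), ((3 : ℕ) : NumberField.RingOfIntegers K) ∈ 𝔭'.asIdeal → 𝔭' ≠ 𝔭 → ∀ (ι' : PadicAlgCl 3 ≃+* ℂ), Summit.BirchSwinnertonDyer.BirchSwinnertonDyer.Theorems.SchneiderFree.BranchInducesPrime 3 ι' 𝔭 → ∀ (ΩK : ℂ) (Ωp : ℂ_[3]) (L : Literature.NumberTheory.EllipticCurves.UnrSeries 3), ΩK ≠ 0 → Ωp ≠ 0 → Literature.NumberTheory.EllipticCurves.IsBDPLFunction ι' 𝔭 κ γ Dt.f ΩK Ωp L → Module.IsTorsion (Literature.NumberTheory.EllipticCurves.IwasawaAlgebra 3) (Summit.BirchSwinnertonDyer.Rank1Residual.X11b.AcSelmer.XAc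 (W.baseChange K) 3 κ 𝔭' ∅ γ) →
    ∃ F₁ : Literature.NumberTheory.EllipticCurves.UnrSeries 3,
      (Summit.BirchSwinnertonDyer.Rank1Residual.X11b.AcSelmer.XAc.charIdeal (W.baseChange K) 3 κ 𝔭' ∅ γ).map (PowerSeries.map (Summit.BirchSwinnertonDyer.Rank1Residual.X11b.Halves.toUnr 3)) = Ideal.span {F₁ ^ 2}

/-- **(AN) [WEAKER — true for the BDP function · leaf ATTACKABLE after a definition request]** the analytic side is a square up
to a unit and a power of 3: `L = u·3^b·L₁²` in `R₀⟦T⟧`. -/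
def SquareRootLFunctionAtThree : Prop :=
  ∀ (W : WeierstrassCurve ℚ) [W.IsElliptic] [W.IsGloballyMinimal] (N : ℕ) [NeZero N] (K : Type) [Field K] [NumberField K] (Dt : Literature.NumberTheory.EllipticCurves.ModularForms.ModularParametrizationData W N), Summit.BirchSwinnertonDyer.Rank1Residual.Additive.ClassO6 W 3 → W.HasSurjectiveModNGaloisRep 3 → W.analyticRank = 1 → W.conductorNorm ℤ = N → Literature.NumberTheory.EllipticCurves.IsImaginaryQuadratic K → Literature.NumberTheory.EllipticCurves.SatisfiesHeegnerHypothesis N K → ∀ (κ : Literature.NumberTheory.EllipticCurves.ZpExtension K 3), κ.IsAnticyclotomic → ∀ (γ : Field.absoluteGaloisGroup K) [Fact (κ.IsTopGenerator γ)] (𝔭 : IsDedekindDomain.HeightOneSpectrum (NumberField.RingOfIntegers K)), ((3 : ℕ) : NumberField.RingOfIntegers K) ∈ 𝔭.asIdeal → 𝔭.asIdeal.ramificationIdx (NumberField.RingOfIntegers ℚ) = 1 → 𝔭.asIdeal.inertiaDeg (NumberField.RingOfIntegers ℚ) = 1 → ∀ (𝔭' : IsDedekindDomain.HeightOneSpectrum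 (NumberField.RingOfIntegers K)), ((3 : ℕ) : NumberField.RingOfIntegers K) ∈ 𝔭'.asIdeal → 𝔭' ≠ 𝔭 → ∀ (ι' : PadicAlgCl 3 ≃+* ℂ), Summit.BirchSwinnertonDyer.BirchSwinnertonDyer.Theorems.SchneiderFree.BranchInducesPrime 3 ι' 𝔭 → ∀ (ΩK : ℂ) (Ωp : ℂ_[3]) (L : Literature.NumberTheory.EllipticCurves.UnrSeries 3), ΩK ≠ 0 → Ωp ≠ 0 → Literature.NumberTheory.EllipticCurves.IsBDPLFunction ι' 𝔭 κ γ Dt.f ΩK Ωp L → Module.IsTorsion (Literature.NumberTheory.EllipticCurves.IwasawaAlgebra 3) (Summit.BirchSwinnertonDyer.Rank1Residual.X11b.AcSelmer.XAc (W.baseChange K) 3 κ 𝔭' ∅ γ) →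
    ∃ (L₁ u : Literature.NumberTheory.EllipticCurves.UnrSeries 3) (b : ℕ), IsUnit u ∧
      L = u * ((3 : ℕ) : Literature.NumberTheory.EllipticCurves.UnrSeries 3) ^ b * L₁ ^ 2

/-- **(ONE) [UNDECIDED · leaf IDEA-NEEDED]** on RIGID rows (the algebraic square root `F₁` or the analytic one `L₁` irreducible in
`R₀⟦T⟧`), `F₁` and `L₁` have a common non-unit factor — one common root in `ℂ₃`, no multiplicity asked. -/
def CommonFactorOnRigidRowsAtThree : Prop :=
  ∀ (W : WeierstrassCurve ℚ) [W.IsElliptic] [W.IsGloballyMinimal] (N : ℕ) [NeZero N] (K : Type) [Field K] [NumberField K] (Dt : Literature.NumberTheory.EllipticCurves.ModularForms.ModularParametrizationData W N), Summit.BirchSwinnertonDyer.Rank1Residual.Additive.ClassO6 W 3 → W.HasSurjectiveModNGaloisRep 3 → W.analyticRank = 1 → W.conductorNorm ℤ = N → Literature.NumberTheory.EllipticCurves.IsImaginaryQuadratic K → Literature.NumberTheory.EllipticCurves.SatisfiesHeegnerHypothesis N K → ∀ (κ : Literature.NumberTheory.EllipticCurves.ZpExtension K 3), κ.IsAnticyclotomic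 → ∀ (γ : Field.absoluteGaloisGroup K) [Fact (κ.IsTopGenerator γ)] (𝔭 : IsDedekindDomain.HeightOneSpectrum (NumberField.RingOfIntegers K)), ((3 : ℕ) : NumberField.RingOfIntegers K) ∈ 𝔭.asIdeal → 𝔭.asIdeal.ramificationIdx (NumberField.RingOfIntegers ℚ) = 1 → 𝔭.asIdeal.inertiaDeg (NumberField.RingOfIntegers ℚ) = 1 → ∀ (𝔭' : IsDedekindDomain.HeightOneSpectrum (NumberField.RingOfIntegers K)), ((3 : ℕ) : NumberField.RingOfIntegers K) ∈ 𝔭'.asIdeal → 𝔭' ≠ 𝔭 → ∀ (ι' : PadicAlgCl 3 ≃+* ℂ), Summit.BirchSwinnertonDyer.BirchSwinnertonDyer.Theorems.SchneiderFree.BranchInducesPrime 3 ι' 𝔭 → ∀ (ΩK : ℂ) (Ωp : ℂ_[3]) (L : Literature.NumberTheory.EllipticCurves.UnrSeries 3), ΩK ≠ 0 → Ωp ≠ 0 → Literature.NumberTheory.EllipticCurves.IsBDPLFunction ι' 𝔭 κ γ Dt.f ΩK Ωp L → Module.IsTorsion (Literature.NumberTheory.EllipticCurves.IwasawaAlgebra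 3) (Summit.BirchSwinnertonDyer.Rank1Residual.X11b.AcSelmer.XAc (W.baseChange K) 3 κ 𝔭' ∅ γ) →
    ∀ (F₁ L₁ u : Literature.NumberTheory.EllipticCurves.UnrSeries 3) (b : ℕ),
      (Summit.BirchSwinnertonDyer.Rank1Residual.X11b.AcSelmer.XAc.charIdeal (W.baseChange K) 3 κ 𝔭' ∅ γ).map (PowerSeries.map (Summit.BirchSwinnertonDyer.Rank1Residual.X11b.Halves.toUnr 3)) = Ideal.span {F₁ ^ 2} →
      IsUnit u → L = u * ((3 : ℕ) : Literature.NumberTheory.EllipticCurves.UnrSeries 3) ^ b * L₁ ^ 2 →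
      (Irreducible F₁ ∨ Irreducible L₁) →
      ∃ P : Literature.NumberTheory.EllipticCurves.UnrSeries 3, ¬ IsUnit P ∧ P ∣ F₁ ∧ P ∣ L₁

/-- **RESIDUAL [= the crux restricted to NON-RIGID rows · tagged as the crux: BARRIER (TraceZero, B1, NoAdmissiblePrimes)]**
on rows where a square generator `F₁` and a square root `L₁` are given but `F₁` is NOT irreducible, the rational inclusion. -/
def RationalInclusionOffRigidRowsAtThree : Prop :=
  ∀ (W : WeierstrassCurve ℚ) [W.IsElliptic] [W.IsGloballyMinimal] (N : ℕ) [NeZero N] (K : Type) [Field K] [NumberField K] (Dt : Literature.NumberTheory.EllipticCurves.ModularForms.ModularParametrizationData W N), Summit.BirchSwinnertonDyer.Rank1Residual.Additive.ClassO6 W 3 → W.HasSurjectiveModNGaloisRep 3 → W.analyticRank = 1 → W.conductorNorm ℤ = N → Literature.NumberTheory.EllipticCurves.IsImaginaryQuadratic K → Literature.NumberTheory.EllipticCurves.SatisfiesHeegnerHypothesis N K → ∀ (κ : Literature.NumberTheory.EllipticCurves.ZpExtension K 3), κ.IsAnticyclotomic → ∀ (γ : Field.absoluteGaloisGroup K)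 [Fact (κ.IsTopGenerator γ)] (𝔭 : IsDedekindDomain.HeightOneSpectrum (NumberField.RingOfIntegers K)), ((3 : ℕ) : NumberField.RingOfIntegers K) ∈ 𝔭.asIdeal → 𝔭.asIdeal.ramificationIdx (NumberField.RingOfIntegers ℚ) = 1 → 𝔭.asIdeal.inertiaDeg (NumberField.RingOfIntegers ℚ) = 1 → ∀ (𝔭' : IsDedekindDomain.HeightOneSpectrum (NumberField.RingOfIntegers K)), ((3 : ℕ) : NumberField.RingOfIntegers K) ∈ 𝔭'.asIdeal → 𝔭' ≠ 𝔭 → ∀ (ι' : PadicAlgCl 3 ≃+* ℂ), Summit.BirchSwinnertonDyer.BirchSwinnertonDyer.Theorems.SchneiderFree.BranchInducesPrime 3 ι' 𝔭 → ∀ (ΩK : ℂ) (Ωp : ℂ_[3]) (L : Literature.NumberTheory.EllipticCurves.UnrSeries 3), ΩK ≠ 0 → Ωp ≠ 0 → Literature.NumberTheory.EllipticCurves.IsBDPLFunction ι' 𝔭 κ γ Dt.f ΩK Ωp L → Module.IsTorsion (Literature.NumberTheory.EllipticCurves.IwasawaAlgebra 3) (Summit.BirchSwinnertonDyer.Rank1Residual.X11b.AcSelmer.XAc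 (W.baseChange K) 3 κ 𝔭' ∅ γ) →
    ∀ (F₁ L₁ u : Literature.NumberTheory.EllipticCurves.UnrSeries 3) (b : ℕ),
      (Summit.BirchSwinnertonDyer.Rank1Residual.X11b.AcSelmer.XAc.charIdeal (W.baseChange K) 3 κ 𝔭' ∅ γ).map (PowerSeries.map (Summit.BirchSwinnertonDyer.Rank1Residual.X11b.Halves.toUnr 3)) = Ideal.span {F₁ ^ 2} →
      IsUnit u → L = u * ((3 : ℕ) : Literature.NumberTheory.EllipticCurves.UnrSeries 3) ^ b * L₁ ^ 2 →
      ¬ Irreducible F₁ →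
      ∃ k : ℕ, ((3 : ℕ) : Literature.NumberTheory.EllipticCurves.UnrSeries 3) ^ k * L ∈
        (Summit.BirchSwinnertonDyer.Rank1Residual.X11b.AcSelmer.XAc.charIdeal (W.baseChange K) 3 κ 𝔭' ∅ γ).map (PowerSeries.map (Summit.BirchSwinnertonDyer.Rank1Residual.X11b.Halves.toUnr 3))

/-- **g0's P1 VERBATIM** (`EisensteinKatoSwap.EisensteinRationalInclusionAtThree`; restated, not importable): the RATIONAL
Eisenstein-side inclusion `∃ k, 3^k · Ch_Λ(X_(∅,0))·R₀⟦T⟧ ⊆ (L)`.  Target of door B. -/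
def EisensteinRationalInclusionAtThree : Prop :=
  ∀ (W : WeierstrassCurve ℚ) [W.IsElliptic] [W.IsGloballyMinimal] (N : ℕ) [NeZero N] (K : Type) [Field K] [NumberField K] (Dt : Literature.NumberTheory.EllipticCurves.ModularForms.ModularParametrizationData W N), Summit.BirchSwinnertonDyer.Rank1Residual.Additive.ClassO6 W 3 → W.HasSurjectiveModNGaloisRep 3 → W.analyticRank = 1 → W.conductorNorm ℤ = N → Literature.NumberTheory.EllipticCurves.IsImaginaryQuadratic K → Literature.NumberTheory.EllipticCurves.SatisfiesHeegnerHypothesis N K → ∀ (κ : Literature.NumberTheory.EllipticCurves.ZpExtension K 3), κ.IsAnticyclotomic → ∀ (γ : Field.absoluteGaloisGroup K) [Fact (κ.IsTopGenerator γ)] (𝔭 : IsDedekindDomain.HeightOneSpectrum (NumberField.RingOfIntegers K)), ((3 : ℕ) : NumberField.RingOfIntegers K) ∈ 𝔭.asIdeal → 𝔭.asIdeal.ramificationIdx (NumberField.RingOfIntegers ℚ) = 1 → 𝔭.asIdeal.inertiaDeg (NumberField.RingOfIntegers ℚ) = 1 → ∀ (𝔭' : IsDedekindDomain.HeightOneSpectrum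 (NumberField.RingOfIntegers K)), ((3 : ℕ) : NumberField.RingOfIntegers K) ∈ 𝔭'.asIdeal → 𝔭' ≠ 𝔭 → ∀ (ι' : PadicAlgCl 3 ≃+* ℂ), Summit.BirchSwinnertonDyer.BirchSwinnertonDyer.Theorems.SchneiderFree.BranchInducesPrime 3 ι' 𝔭 → ∀ (ΩK : ℂ) (Ωp : ℂ_[3]) (L : Literature.NumberTheory.EllipticCurves.UnrSeries 3), ΩK ≠ 0 → Ωp ≠ 0 → Literature.NumberTheory.EllipticCurves.IsBDPLFunction ι' 𝔭 κ γ Dt.f ΩK Ωp L → Module.IsTorsion (Literature.NumberTheory.EllipticCurves.IwasawaAlgebra 3) (Summit.BirchSwinnertonDyer.Rank1Residual.X11b.AcSelmer.XAc (W.baseChange K) 3 κ 𝔭' ∅ γ) → ∃ k : ℕ, ∀ x ∈ ((Summit.BirchSwinnertonDyer.Rank1Residual.X11b.AcSelmer.XAc.charIdeal (W.baseChange K) 3 κ 𝔭' ∅ γ).map (PowerSeries.map (Summit.BirchSwinnertonDyer.Rank1Residual.X11b.Halves.toUnr 3))), (3 : Literature.NumberTheory.EllipticCurves.UnrSeries 3)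 ^ k * x ∈ Ideal.span {L}

/-- **P1 OFF `L₁`-RIGID ROWS [RESIDUAL for door B]** — g0's P1 restricted to rows where a square root `L₁` is given but is NOT
irreducible. -/
def EisensteinInclusionOffRigidRowsAtThree : Prop :=
  ∀ (W : WeierstrassCurve ℚ) [W.IsElliptic] [W.IsGloballyMinimal] (N : ℕ) [NeZero N] (K : Type) [Field K] [NumberField K] (Dt : Literature.NumberTheory.EllipticCurves.ModularForms.ModularParametrizationData W N), Summit.BirchSwinnertonDyer.Rank1Residual.Additive.ClassO6 W 3 → W.HasSurjectiveModNGaloisRep 3 → W.analyticRank = 1 → W.conductorNorm ℤ = N → Literature.NumberTheory.EllipticCurves.IsImaginaryQuadratic K → Literature.NumberTheory.EllipticCurves.SatisfiesHeegnerHypothesis N K → ∀ (κ : Literature.NumberTheory.EllipticCurves.ZpExtension K 3), κ.IsAnticyclotomic → ∀ (γ : Field.absoluteGaloisGroup K) [Fact (κ.IsTopGenerator γ)] (𝔭 : IsDedekindDomain.HeightOneSpectrum (NumberField.RingOfIntegers K)), ((3 : ℕ) : NumberField.RingOfIntegers K) ∈ 𝔭.asIdeal → 𝔭.asIdeal.ramificationIdx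 (NumberField.RingOfIntegers ℚ) = 1 → 𝔭.asIdeal.inertiaDeg (NumberField.RingOfIntegers ℚ) = 1 → ∀ (𝔭' : IsDedekindDomain.HeightOneSpectrum (NumberField.RingOfIntegers K)), ((3 : ℕ) : NumberField.RingOfIntegers K) ∈ 𝔭'.asIdeal → 𝔭' ≠ 𝔭 → ∀ (ι' : PadicAlgCl 3 ≃+* ℂ), Summit.BirchSwinnertonDyer.BirchSwinnertonDyer.Theorems.SchneiderFree.BranchInducesPrime 3 ι' 𝔭 → ∀ (ΩK : ℂ) (Ωp : ℂ_[3]) (L : Literature.NumberTheory.EllipticCurves.UnrSeries 3), ΩK ≠ 0 → Ωp ≠ 0 → Literature.NumberTheory.EllipticCurves.IsBDPLFunction ι' 𝔭 κ γ Dt.f ΩK Ωp L → Module.IsTorsion (Literature.NumberTheory.EllipticCurves.IwasawaAlgebra 3) (Summit.BirchSwinnertonDyer.Rank1Residual.X11b.AcSelmer.XAc (W.baseChange K) 3 κ 𝔭' ∅ γ) →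
    ∀ (F₁ L₁ u : Literature.NumberTheory.EllipticCurves.UnrSeries 3) (b : ℕ),
      (Summit.BirchSwinnertonDyer.Rank1Residual.X11b.AcSelmer.XAc.charIdeal (W.baseChange K) 3 κ 𝔭' ∅ γ).map (PowerSeries.map (Summit.BirchSwinnertonDyer.Rank1Residual.X11b.Halves.toUnr 3)) = Ideal.span {F₁ ^ 2} →
      IsUnit u → L = u * ((3 : ℕ) : Literature.NumberTheory.EllipticCurves.UnrSeries 3) ^ b * L₁ ^ 2 →
      ¬ Irreducible L₁ →
      ∃ k : ℕ, ∀ x ∈ ((Summit.BirchSwinnertonDyer.Rank1Residual.X11b.AcSelmer.XAc.charIdeal (W.baseChange K) 3 κ 𝔭' ∅ γ).map (PowerSeries.map (Summit.BirchSwinnertonDyer.Rank1Residual.X11b.Halves.toUnr 3))), (3 : Literature.NumberTheory.EllipticCurves.UnrSeries 3) ^ k * x ∈ Ideal.span {L}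

/-! ## §C  Kernels -/

/-- **DOOR A (kernel-checked, concludes the crux BY NAME).** (SQ) ∧ (AN) ∧ (ONE) ∧ RESIDUAL ⟹ 24207.  On `F₁`-rigid rows:
a common non-unit factor and irreducibility of `F₁` give `F₁ ∣ L₁` (`dvd_of_irreducible_of_common_nonunit_factor`), hence
`L ∈ (F₁²)` with `k = 0` (`mem_span_sq_of_dvd`).  Degenerate frame (`X` not torsion, `Ch = Λ`): `k = 0`. -/
theorem rationalSplitIMCInclusionAtThree_of_amplification
    (hSQ : SquareCharGeneratorAtThree) (hAN : SquareRootLFunctionAtThree)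
    (hONE : CommonFactorOnRigidRowsAtThree) (hRES : RationalInclusionOffRigidRowsAtThree) :
    Summit.BirchSwinnertonDyer.BirchSwinnertonDyer.Theses.UniversalToricDescent.RationalSplitIMCInclusionAtThree := by
  intro W _ _ N _ K _ _ Dt hO6 hsurj hr1 hN hK hH κ hκ γ _ 𝔭 h𝔭 he hf 𝔭' h𝔭' hne ι' hι ΩK Ωp L hΩK hΩp hL
  by_cases htor : Module.IsTorsion (Literature.NumberTheory.EllipticCurves.IwasawaAlgebra 3)
      (Summit.BirchSwinnertonDyer.Rank1Residual.X11b.AcSelmer.XAc (W.baseChange K) 3 κ 𝔭' ∅ γ)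
  · obtain ⟨F₁, hCh⟩ :=
      hSQ W N K Dt hO6 hsurj hr1 hN hK hH κ hκ γ 𝔭 h𝔭 he hf 𝔭' h𝔭' hne ι' hι ΩK Ωp L hΩK hΩp hL htor
    obtain ⟨L₁, u, b, hu, hLeq⟩ :=
      hAN W N K Dt hO6 hsurj hr1 hN hK hH κ hκ γ 𝔭 h𝔭 he hf 𝔭' h𝔭' hne ι' hι ΩK Ωp L hΩK hΩp hL htor
    by_cases hF₁ : Irreducible F₁
    · obtain ⟨P, hPu, hPF, hPL⟩ :=
        hONE W N K Dt hO6 hsurj hr1 hN hK hH κ hκ γ 𝔭 h𝔭 he hf 𝔭' h𝔭' hne ι' hι ΩK Ωp L hΩK hΩp hL htor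
          F₁ L₁ u b hCh hu hLeq (Or.inl hF₁)
      exact mem_span_sq_of_dvd hCh hLeq (dvd_of_irreducible_of_common_nonunit_factor hF₁ hPu hPF hPL)
    · exact hRES W N K Dt hO6 hsurj hr1 hN hK hH κ hκ γ 𝔭 h𝔭 he hf 𝔭' h𝔭' hne ι' hι ΩK Ωp L hΩK hΩp hL htor
        F₁ L₁ u b hCh hu hLeq hF₁
  · refine ⟨0, ?_⟩
    have htop : Summit.BirchSwinnertonDyer.Rank1Residual.X11b.AcSelmer.XAc.charIdeal (W.baseChange K) 3 κ 𝔭' ∅ γ = ⊤ :=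
      Summit.BirchSwinnertonDyer.BirchSwinnertonDyer.Theorems.charIdeal_eq_top_of_not_isTorsion (p := 3) _ htor
    rw [htop, Ideal.map_top]; exact Submodule.mem_top

/-- **DOOR B (kernel-checked, concludes g0's P1 verbatim).** (SQ) ∧ (AN) ∧ (ONE) ∧ (P1 off `L₁`-rigid rows) ⟹ P1.  On `L₁`-rigid
rows: a common non-unit factor and irreducibility of `L₁` give `L₁ ∣ F₁`, hence `3^b·(F₁²) ⊆ (L)` (`span_sq_le_of_dvd`).  g0's
checked `EisensteinKatoSwap.rationalSplitIMCInclusionAtThree_of_eisenstein_of_lambdaDominance : P1 → P2 → crux` then applies. -/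
theorem eisensteinInclusion_of_amplification
    (hSQ : SquareCharGeneratorAtThree) (hAN : SquareRootLFunctionAtThree)
    (hONE : CommonFactorOnRigidRowsAtThree) (hRES : EisensteinInclusionOffRigidRowsAtThree) :
    EisensteinRationalInclusionAtThree := by
  intro W _ _ N _ K _ _ Dt hO6 hsurj hr1 hN hK hH κ hκ γ _ 𝔭 h𝔭 he hf 𝔭' h𝔭' hne ι' hι ΩK Ωp L hΩK hΩp hL htor
  obtain ⟨F₁, hCh⟩ :=
    hSQ W N K Dt hO6 hsurj hr1 hN hK hH κ hκ γ 𝔭 h𝔭 he hf 𝔭' h𝔭' hne ι' hι ΩK Ωp L hΩK hΩp hL htor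
  obtain ⟨L₁, u, b, hu, hLeq⟩ :=
    hAN W N K Dt hO6 hsurj hr1 hN hK hH κ hκ γ 𝔭 h𝔭 he hf 𝔭' h𝔭' hne ι' hι ΩK Ωp L hΩK hΩp hL htor
  have h3 : ((3 : ℕ) : Literature.NumberTheory.EllipticCurves.UnrSeries 3) =
      (3 : Literature.NumberTheory.EllipticCurves.UnrSeries 3) := Nat.cast_ofNat
  by_cases hL₁ : Irreducible L₁
  · obtain ⟨P, hPu, hPF, hPL⟩ :=
      hONE W N K Dt hO6 hsurj hr1 hN hK hH κ hκ γ 𝔭 h𝔭 he hf 𝔭' h𝔭' hne ι' hι ΩK Ωp L hΩK hΩp hL htor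
        F₁ L₁ u b hCh hu hLeq (Or.inr hL₁)
    have hLeq' : L = u * (3 : Literature.NumberTheory.EllipticCurves.UnrSeries 3) ^ b * L₁ ^ 2 := by rw [← h3]; exact hLeq
    exact span_sq_le_of_dvd hCh hu hLeq' (dvd_of_irreducible_of_common_nonunit_factor hL₁ hPu hPL hPF)
  · have hk := hRES W N K Dt hO6 hsurj hr1 hN hK hH κ hκ γ 𝔭 h𝔭 he hf 𝔭' h𝔭' hne ι' hι ΩK Ωp L hΩK hΩp hL htor
      F₁ L₁ u b hCh hu hLeq hL₁
    exact hk

end Summit.BirchSwinnertonDyer.BirchSwinnertonDyer.Cruxes.RationalSplitIMCInclusionAtThree.EisensteinOrbitAmplification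

end
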